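import Summits.BirchSwinnertonDyer.BirchSwinnertonDyer.Theorems.PrintCFramBottomClassIndexLawFiveLeLevelDictionaryBetaPartner
import Literature.NumberTheory.EllipticCurves.BSDRootNumberSmallConductorAssemblyProofs
import Literature.NumberTheory.EllipticCurves.ComplexMultiplicationLFunctionIsogenyHoldsProofs
import Literature.NumberTheory.EllipticCurves.AnalyticRankOrderProofs
import Literature.NumberTheory.EllipticCurves.ComplexMultiplication
import HarnessLib

/-!
# Route `PrintCFram`, crux C2 `BottomClassIndexLawFiveLe` (stmt-BirchSwinnertonDyer-20372), line
# `eisenstein-resource-bdp-line` (registry v19; LEAD g10 report ADDENDUM 1 «B2′/C is an `L`-VALUE statement»):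
# **THE `L`-VALUE READING OF THE RANK-ZERO LEVEL DICTIONARY** — an Eisenstein-IRREGULAR class member with `L(W,1) ≠ 0`
# has `p ∣ #Ш_an` on its rational `p`-isogeny class (on `W` or on its partner `W₁`), granted Mazur–Wiles Thm. 2 and
# Burungale–Flach 2024 Cor. 2 (the BSD formula for CM curves with `L(E,1) ≠ 0`)
# (cell `bsd-print-cfram`, width seat `bsd-line-cfram-p1-w5` g3; helper `--supports` 20372; 0 defs, 0 facts, 0 sorry)

HONEST FRAMING. Nothing about BSD is proved here beyond what the named facts give, and nothing of any stub. CONDITIONAL on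
`MazurWiles1984.thm2_card_oddChiClassGroup_eq_bernoulli`, on `bsdTriple_of_hasCM_of_L_one_ne_zero` (Burungale–Flach 2024 Cor. 2 /
Rubin 1991 — conjunct 4 of `stub_prints`), on modularity `hasEntireLFunction_rat` (for `r_an = 0 ⟺ L(W,1) ≠ 0`), and on
`B_{1,ψ̃⁻¹} ≠ 0`. Applied to the admissible Heegner twists `W^{(d)}` of a REGULAR rank-one member (class factor of the twist = the
`K″`-factor of `(W, K″)`, w3 g7's `OffLocusTwistFactor.classFactor_twist_eq_fieldFactor`) it says: the premise of B2′ / the failure of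
stub C `stub_heegnerField_of_unitClassFactor` forces, for EVERY admissible `K″` with `L(W^{(d)},1) ≠ 0`, `p ∣ #Ш_an` on the twist's
`p`-isogeny class — so C follows from ONE admissible `d` with `L(W^{(d)},1) ≠ 0` and `p ∤ #Ш_an` on both models (a horizontal
non-vanishing-mod-`p` statement for the quadratic-twist family; not in print for `p ≥ 7`, kriz-li-cover card presearch).

* §1 `one_le_padicValRat_shaAn_of_sha_of_bsdp` — `BSD_p(A)` (the tree's `BSDp`: `#Ш_an(A) = q`,
  `ord_p q = ord_p #Ш(A)[p^∞]`) and a non-zero `c ∈ Ш(A)` with `p • c = 0` ⟹ `1 ≤ ord_p q`.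
* §2 **`one_le_padicValRat_shaAn_or_partner_of_classFactor`** — class member with `L(W,1) ≠ 0`, odd datum with `hss`,
  `B_{1,ψ̃⁻¹} ≠ 0`, `‖B_{1,ψ̃⁻¹}‖_p ≤ p⁻¹` ⟹ `∃ q, #Ш_an(W) = q ∧ 1 ≤ ord_p q`, OR the same for a globally minimal CM partner
  `W₁`, CM-ramified, `p`-isogenous to `W` (whose `L(W₁,1) = L(W,1) ≠ 0`).

THEOREMS ONLY; no definition, no named fact, no `sorry`. BSD is not proved by any of this; no summit statement is proved by this seat.
References: [MazurWiles1984] Thm. 2; [BurungaleFlach2024] Cor. 2; [Rubin1991] Thm. 1; [Miller2011LMS] Def. 1.1; [MilneADT2006]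
Thm. I.7.3; the LEAD g10 report ADDENDUM 1–2; the kriz-li-cover line card (bsd-idea-7 g12).
-/

set_option autoImplicit false
-- `…BirchSwinnertonDyer.BirchSwinnertonDyer.Theorems…` is the problem's mandated namespace (D-0017).
set_option linter.dupNamespace false

noncomputable section

open scoped Classical

namespace Summit.BirchSwinnertonDyer.BirchSwinnertonDyer.Theorems.PrintCFram.LevelDictionaryBeta

open NumberField IsDedekindDomain Field WeierstrassCurve DirichletCharacter
open Literature.NumberTheory.EllipticCurves Literature.NumberTheory.GaloisRepresentations
  Literature.NumberTheory.EllipticCurves.KrizLi2019 Literature.NumberTheory.NumberFields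
open Literature.NumberTheory.EllipticCurves.Rank1Residual (CMRamified)

variable {p : ℕ} [hp : Fact p.Prime]

/-! ## §1 `BSD_p` and a non-zero `p`-torsion class in `Ш` give `p ∣ #Ш_an` -/

/-- **`BSD_p(A)` + `Ш(A)[p] ≠ 0` ⟹ `ord_p #Ш_an(A) ≥ 1`.** With the tree's `BSDp A p` (`#Ш_an = q ∈ ℚ`,
`ord_p q = ord_p #Ш(A)[p^∞]`, `Ш(A)[p^∞]` finite) and a non-zero `c ∈ Ш(A)` killed by `p`: `c` has order `p`, lies in `Ш(A)[p^∞]`,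
so `p ∣ #Ш(A)[p^∞]` and `ord_p q ≥ 1`. [cite: Miller2011LMS, Def. 1.1 (arXiv:1010.2431 p. 3)] -/
theorem one_le_padicValRat_shaAn_of_sha_of_bsdp (A : WeierstrassCurve ℚ) [A.IsElliptic] (hBSD : BSDp A p)
    {c : A.galH1} (hc : c ∈ A.sha) (hc0 : c ≠ 0) (hpc : p • c = 0) :
    ∃ q : ℚ, shaAn A = (q : ℂ) ∧ 1 ≤ padicValRat p q := by
  obtain ⟨-, hfin, q, hq, hv⟩ := hBSD
  haveI := hfin
  refine ⟨q, hq, ?_⟩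
  -- `c` as an element of `Ш(A)`, of order `p`, inside the `p`-primary component
  set c' : A.sha := ⟨c, hc⟩ with hc'
  have hc'0 : c' ≠ 0 := fun h ↦ hc0 (congrArg Subtype.val h)
  have hpc' : p • c' = 0 := Subtype.ext hpc
  have hord : addOrderOf c' = p := addOrderOf_eq_prime hpc' hc'0
  have hmem : c' ∈ AddCommGroup.primaryComponent A.sha p :=
    (AddCommGroup.mem_primaryComponent_iff_addOrderOf (p := p)).mpr ⟨1, by rw [pow_one, hord]⟩
  set c'' : AddCommGroup.primaryComponent A.sha p := ⟨c', hmem⟩ with hc''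
  have hord'' : addOrderOf c'' = p := by
    rw [← AddSubgroup.addOrderOf_coe c'']
    exact hord
  have hdvd : p ∣ Nat.card (AddCommGroup.primaryComponent A.sha p) := by
    have h := addOrderOf_dvd_natCard c''
    rwa [hord''] at h
  have hne : Nat.card (AddCommGroup.primaryComponent A.sha p) ≠ 0 := Nat.card_pos.ne'
  have h1 : 1 ≤ padicValNat p (Nat.card (AddCommGroup.primaryComponent A.sha p)) := one_le_padicValNat_of_dvd hne hdvd
  rw [hv]
  exact_mod_cast h1

/-! ## §2 On the class: `L(W,1) ≠ 0` and a non-unit class factor give `p ∣ #Ш_an` on the isogeny class -/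

section Class

variable (W : WeierstrassCurve ℚ) [W.IsElliptic] [W.IsGloballyMinimal]

/-- **THE `L`-VALUE READING (CONDITIONAL on Mazur–Wiles Thm. 2, Burungale–Flach 2024 Cor. 2, modularity).** `W/ℚ` globally
minimal with CM, `p ≥ 5` CM-RAMIFIED, `L(W,1) ≠ 0`; `(f, ψ, ω)` odd datum with the trace form; `B_{1,ψ̃⁻¹} ≠ 0` and the CLASS
FACTOR NON-UNIT `‖B_{1,ψ̃⁻¹}‖_p ≤ p⁻¹`. THEN `#Ш_an(W) = q` with `ord_p q ≥ 1`, OR the same holds for a globally minimal CM curve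
`W₁`, CM-ramified at `p` and `p`-isogenous to `W` over `ℚ` (so `L(W₁,1) = L(W,1) ≠ 0`). PROOF: `r_an(W) = 0`
(`analyticRank_eq_zero_iff`), so `W(ℚ)` is finite by Burungale–Flach's rank formula; w5 g3's
`sha_or_partner_sha_of_classFactor_of_finite` gives `Ш[p] ≠ 0` on `W` or `W₁`; `BSD_p` of that model (Burungale–Flach,
`forall_bsdp_of_bsdTriple'`) and §1 conclude. This is the rank-zero companion of B1 at the additive prime — the
Eisenstein congruence «irregular ⟹ `p ∣ L^{alg}`» (Mazur 1979 / Vatsal 1999 at `p ∤ N`) in `#Ш_an`-currency on the class.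
[cite: MazurWiles1984, Thm. 2 (p. 216)] [cite: BurungaleFlach2024, Cor. 2] [cite: Miller2011LMS, Def. 1.1]
[cite: MilneADT2006, Thm. I.7.3] -/
theorem one_le_padicValRat_shaAn_or_partner_of_classFactor
    (hBF : bsdTriple_of_hasCM_of_L_one_ne_zero) (hmod : hasEntireLFunction_rat)
    (hMW : MazurWiles1984.thm2_card_oddChiClassGroup_eq_bernoulli)
    (hCM : W.HasCM) (hram : CMRamified W p) (h5 : 5 ≤ p) (hL : W.entireLFunction 1 ≠ 0)
    {f : ℕ} [NeZero f] (ψ : DirichletCharacter ℚ_[p] f) (ω : DirichletCharacter ℚ_[p] p)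
    (hψ : ψ.Odd) (hω : IsTeichmullerCharacter ω)
    (hss : ∀ ℓ : ℕ, ℓ.Prime → ¬ (ℓ ∣ p * W.conductorNorm ℤ) →
      ‖((W.LFunction ℓ : ℤ) : ℚ_[p]) - (ψ (ℓ : ZMod f) + ψ⁻¹ (ℓ : ZMod f) * ω (ℓ : ZMod p))‖ < 1)
    (hB0 : bernoulliOnePrim ψ⁻¹ ≠ 0) (hB : ‖bernoulliOnePrim ψ⁻¹‖ ≤ (p : ℝ)⁻¹) :
    (∃ q : ℚ, shaAn W = (q : ℂ) ∧ 1 ≤ padicValRat p q) ∨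
    ∃ (W₁ : WeierstrassCurve ℚ) (_ : W₁.IsElliptic) (_ : W₁.IsGloballyMinimal),
      W₁.HasCM ∧ CMRamified W₁ p ∧ (∃ φ : Isogeny W W₁, φ.degree = p) ∧ W₁.entireLFunction 1 ≠ 0 ∧
      ∃ q : ℚ, shaAn W₁ = (q : ℂ) ∧ 1 ≤ padicValRat p q := by
  -- `r_an(W) = 0`, so `W(ℚ)` is finite (Burungale–Flach's rank formula)
  have hr : W.analyticRank = 0 := (W.analyticRank_eq_zero_iff_holds (hmod W)).mpr hL
  have hT : W.BSDTriple := hBF W hCM hL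
  have hrank : W.mordellWeilRank = 0 := by rw [← hT.1, hr]
  have hfin : Finite W.toAffine.Point := W.mordellWeilRank_eq_zero_iff_holds.mp hrank
  rcases sha_or_partner_sha_of_classFactor_of_finite W hMW hCM hram h5 hfin ψ ω hψ hω hss hB0 hB with
    ⟨c, hc, hc0, hpc⟩ | ⟨W₁, _, _, hCM₁, hram₁, ⟨φ, hφ⟩, -, c, hc, hc0, hpc⟩
  · exact Or.inl (one_le_padicValRat_shaAn_of_sha_of_bsdp W (forall_bsdp_of_bsdTriple' W hT p hp.out) hc hc0 hpc)
  · right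
    have hiso : IsIsogenous W W₁ := ⟨φ⟩
    have hr₁ : W₁.analyticRank = 0 := (analyticRank_eq_of_isIsogenous' hiso).symm.trans hr
    have hL₁ : W₁.entireLFunction 1 ≠ 0 := (W₁.analyticRank_eq_zero_iff_holds (hmod W₁)).mp hr₁
    have hT₁ : W₁.BSDTriple := hBF W₁ hCM₁ hL₁
    exact ⟨W₁, ‹_›, ‹_›, hCM₁, hram₁, ⟨φ, hφ⟩, hL₁,
      one_le_padicValRat_shaAn_of_sha_of_bsdp W₁ (forall_bsdp_of_bsdTriple' W₁ hT₁ p hp.out) hc hc0 hpc⟩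

end Class

end Summit.BirchSwinnertonDyer.BirchSwinnertonDyer.Theorems.PrintCFram.LevelDictionaryBeta

end
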